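import Literature.MathematicalPhysics.QuantumFieldTheory.Balaban1983to89.B1Eq324BenfattoClassAppendixC
import Literature.MathematicalPhysics.QuantumFieldTheory.Balaban1983to89.B1Eq324BenfattoClassEntryRows
import Literature.MathematicalPhysics.QuantumFieldTheory.Balaban1983to89.B1Eq324BenfattoKernelSect5ClassRows
import Literature.MathematicalPhysics.QuantumFieldTheory.Balaban1983to89.B1Eq324BenfattoKernelOfPrecision
import HarnessLib

/-!
# `Balaban1983to89.B1Eq324BenfattoClassEntryFromCovariance` — [BenfattoEtAl1978] Appendix C 1) (C.2)–(C.5) p. 164 for the class of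
# [Balaban1985BackgroundPropagators] Sect. E p. 428, ENTERED FROM THE COVARIANCE SIDE: a symmetric, uniformly elliptic, bounded, entrywise
# exponentially decaying COVARIANCE `G` on a finite `Λ ⊂ ℤ^d` puts its PRECISION `A := G⁻¹` in the class — symmetric, `1/Λ_G`-coercive,
# exponentially decaying, with ALL SIX displayed class rows `hJc hV hM hV₂ hM₂ hV₄` at explicit constants UNIFORM IN `Λ`; PROVED, no definition

statement-level skeleton of published theorems with citation tags; proofs where landed; nothing here is a claim about the
Yang–Mills mass gap

v1.1 (docstring-only; referee ref-P READ-141 NIT-1): the four decl cite tags no longer carry the locator «(1.16)–(1.18) p.180» (CMP 99 is pp. 389–434;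
the string was inherited from `…KernelSect5ClassRows`); they cite [Balaban1985BackgroundPropagators] Sect. E p. 428 only.  No statement, proof or name changed.

WHY THIS MODULE (cell `pub-ymgap`, width seat `dag-n08-w5` gen 2, CLAIM-3 = seat n08-d's OFFER-69; node N08 [Balaban1985UV3]; the
[BenfattoEtAl1978] source chain behind the (α)-row `h324`).  Every theorem of the class road (`…KernelSect5LowerAssembly(Stop)`,
`…KernelSect5UpperAssembly`, the per-instance sandwich `…Eq324Signed.eq324_of_sandwich_consts`) is stated for a class MEMBER `(Λ, A)`: a
symmetric `γ_A`-coercive PRECISION `A : Matrix Λ Λ ℝ` with the six displayed rows in the Euclidean site distance `|e − e′|₂ = √(Σ_j (e_j − e′_j)²)`.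
But the Gaussian measure to which [Balaban1985UV3] applies «the cumulant expansion formula (3.24)» is given through its COVARIANCE — «a Gaussian
measure with a covariance having an exponential decay property (and many other properties, see Sect. E in [5])» (p. 261; seat n08-b's
`N08-CLASS-TOOLKIT.md` §4 (7)).  n08-b's `…ClassAppendixC` §6 built the door (`coercive_inv_of_form_le`: `⟨x,Gx⟩ ≤ Λ_G‖x‖²` ⇒ `G⁻¹` is
`1/Λ_G`-elliptic; `abs_inv_apply_le_exp` applied TO `G`: Combes–Thomas decay of `G⁻¹`), n08-d's `…ClassEntryRows` §2/§4 the rows from lattice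
geometry and from entrywise decay.  This file WALKS THROUGH THE DOOR once and for all: ONE ∧-package «elliptic exponentially decaying
covariance ⇒ class member with explicit constants», plus the two rate choices (`θ₁` for the covariance's own Combes–Thomas row, `θ` for the
precision's) as existence statements — so an instantiation at B10's data holding propagator bounds in covariance currency meets every binder
of the class theorems by ONE `obtain`.

THE DICTIONARY.  Data: `Λ : Finset (Site d)`, `G : Matrix Λ Λ ℝ` (the covariance), hypotheses `hGs : G e e′ = G e′ e`,
`hg : g·Σ_e x_e² ≤ Σ_{e,e′} G e e′ x_e x_{e′}` (`0 < g`), `hΛG : Σ_{e,e′} G e e′ x_e x_{e′} ≤ Λ_G·Σ_e x_e²`, `hGdec : |G e e′| ≤ K_G·e^{−κ|e−e′|₂}`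
(`0 ≤ K_G`, `0 < κ`).  Letters written INLINE (no `def`): the lattice constant `K_d(c) := (2/(1 − e^{−c/√d})·e^{c/√d})^d` of
`…ConnLength.sum_exp_neg_mul_cubeDist_le`, and the covariance's Combes–Thomas row `J_G(θ₁) := K_G·(32θ₁²/κ²)·K_d(κ/2)` at a rate `θ₁ ≤ κ/4`.

WHAT IS PROVED (standard axioms; no `sorry`; no definition).
* §1 the precision `A := G⁻¹`: `inv_symm_of_coercive` (symmetric, `…KernelOfPrecision.inv_apply_comm`), `inv_coercive_of_form_le` (`1/Λ_G`-coercive in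
  the class binder shape, n08-b's `coercive_inv_of_form_le`), `cov_rowDefect_le` (G's OWN Euclidean Combes–Thomas row `≤ J_G(θ₁)`, n08-d's
  `classRow_Jc_le_of_abs_le_exp` AT `G`), ★★ `abs_inv_apply_le_exp_of_covariance` / `abs_inv_apply_le_mul_exp_of_covariance`
  (`J_G(θ₁) < g` ⇒ `|G⁻¹ x y| ≤ e^{−θ₁|x−y|₂}/(g − J_G(θ₁))` — (C.2) for the class, precision side, from covariance data).
* §2 the precision rows of `G⁻¹` at `0 ≤ θ ≤ θ₁/4`: `classRow_Jc_le_of_covariance` (`≤ (1/(g − J_G))·(32θ²/θ₁²)·K_d(θ₁/2)`, `→ 0` as `θ → 0`),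
  `classRow_M_le_of_covariance` (`≤ (1/(g − J_G))·((1 + 2/θ₁)·K_d(θ₁/2))`), `classRow_M₂_le_of_covariance` (`≤ (1/(g − J_G))·K_d(θ₁/2)`) — n08-d's §4 BY
  NAME at `(K, κ) := (1/(g − J_G), θ₁)`; the growth rows `hV hV₂ hV₄` are n08-d's `classRow_V_le/V₂/V₄` (not restated).
* §3 ★★★ `classRows_of_covariance` — symmetric ∧ `1/Λ_G`-coercive ∧ the six rows in the order `hJc hV hM hV₂ hM₂ hV₄` of the class theorems,
  explicit constants, UNIFORM IN `Λ`; `exists_covRate` (`∃ θ₁ ∈ (0, κ/4]` with `J_G(θ₁) < g`); `exists_precisionRate` (`0 < Λ_G` ⇒ `∃ θ ∈ (0, θ₁/4]`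
  with `J_c(G⁻¹, θ) < 1/Λ_G`); ★★★ `exists_classRows_of_covariance` (`∃ θ γ_A J_c V M V₂ M₂ V₄`, `0 < θ`, `0 < γ_A`, `J_c < γ_A`, symmetric,
  `γ_A`-coercive, six rows).
HONEST SCOPE.  [folklore] matrix/lattice bookkeeping for OUR class form (Combes–Thomas 1973 on the covariance, by name); NO statement about
[Balaban1985UV3]'s actual fluctuation covariance `C^{(k)}` of (58) — that it is symmetric, elliptic, bounded and exponentially decaying at the pin is
the in-edge N06 ([Balaban1985BackgroundPropagators] Sect. E), NOT claimed here; the corridor guard `J_c/(cosh θw − 1) < γ_A` of the class theorems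
stays the consumer's width choice; count-neutral for N08; nothing about d = 4, the continuum, OS axioms, a mass gap or the Clay problem.
-/

noncomputable section

open Finset Matrix
open scoped BigOperators

namespace Literature.MathematicalPhysics.QuantumFieldTheory.Balaban1983to89.B1Eq324BenfattoClassEntryFromCovariance

open Literature.MathematicalPhysics.QuantumFieldTheory.Balaban1983to89.B1Eq324BenfattoLemma
open Literature.MathematicalPhysics.QuantumFieldTheory.Balaban1983to89.B1Eq324BenfattoClassAppendixC
  (posDef_of_coercive abs_inv_apply_le_exp coercive_inv_of_form_le)
open Literature.MathematicalPhysics.QuantumFieldTheory.Balaban1983to89.B1Eq324BenfattoClassEntryRows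
  (classRow_V_le classRow_V₂_le classRow_V₄_le classRow_Jc_le_of_abs_le_exp classRow_M_le_of_abs_le_exp classRow_M₂_le_of_abs_le_exp)
open Literature.MathematicalPhysics.QuantumFieldTheory.Balaban1983to89.B1Eq324BenfattoKernelSect5ClassRows (l2_self l2_comm l2_triangle)
open Literature.MathematicalPhysics.QuantumFieldTheory.Balaban1983to89.B1Eq324BenfattoKernelOfPrecision (inv_apply_comm)

variable {d : ℕ} {Λ : Finset (B1Eq324BenfattoLemma.Site d)} {G : Matrix Λ Λ ℝ} {g ΛG KG κ : ℝ}

/-! ## §0  One elementary rate choice (private plumbing) -/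

/-- `C ≥ 0`, `b > 0`, `t > 0` ⇒ some `θ ∈ (0, b]` has `C·θ² < t` (`θ := min b (t/(Cb + 1))`: `Cθ² ≤ Cb·θ ≤ Cb·t/(Cb + 1) < t`). [folklore] -/
private theorem exists_small_rate {C b t : ℝ} (hC : 0 ≤ C) (hb : 0 < b) (ht : 0 < t) :
    ∃ θ : ℝ, 0 < θ ∧ θ ≤ b ∧ C * θ ^ 2 < t := by
  have hden : 0 < C * b + 1 := by positivity
  have hθ0 : 0 < min b (t / (C * b + 1)) := lt_min hb (div_pos ht hden)
  refine ⟨min b (t / (C * b + 1)), hθ0, min_le_left _ _, ?_⟩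
  set θ := min b (t / (C * b + 1)) with hθ
  have h1 : θ ≤ b := min_le_left _ _
  have h2 : θ ≤ t / (C * b + 1) := min_le_right _ _
  calc C * θ ^ 2 = C * θ * θ := by ring
    _ ≤ C * b * θ := by gcongr
    _ ≤ C * b * (t / (C * b + 1)) := by gcongr
    _ = C * b * t / (C * b + 1) := (mul_div_assoc _ _ _).symm
    _ < t := by
        rw [div_lt_iff₀ hden]
        nlinarith

/-- The lattice constant `K_d(c) = (2/(1 − e^{−c/√d})·e^{c/√d})^d` is non-negative for `c ≥ 0` (`e^{−c/√d} ≤ 1`). [folklore] -/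
private theorem latticeConst_nonneg {c : ℝ} (hc : 0 ≤ c) :
    0 ≤ (2 / (1 - Real.exp (-(c / Real.sqrt d))) * Real.exp (c / Real.sqrt d)) ^ d := by
  apply pow_nonneg
  refine mul_nonneg (div_nonneg zero_le_two ?_) (Real.exp_pos _).le
  have h : Real.exp (-(c / Real.sqrt d)) ≤ 1 :=
    Real.exp_le_one_iff.mpr (neg_nonpos.mpr (div_nonneg hc (Real.sqrt_nonneg _)))
  linarith

/-! ## §1  The precision `A := G⁻¹` of an elliptic, bounded, exponentially decaying covariance -/

/-- **`G⁻¹` is symmetric** for a symmetric coercive (`g·‖x‖² ≤ ⟨x,Gx⟩`, `g > 0`) covariance `G` (positive definite ⇒ invertible, transpose of the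
inverse). [cite: HornJohnson2013, §0.7.3 (inverse of a symmetric matrix)] -/
theorem inv_symm_of_coercive (hGs : ∀ e e', G e e' = G e' e) (hg0 : 0 < g)
    (hg : ∀ x : Λ → ℝ, g * ∑ e, x e ^ 2 ≤ ∑ e, ∑ e', G e e' * x e * x e') (e e' : Λ) :
    (G⁻¹ : Matrix Λ Λ ℝ) e e' = (G⁻¹ : Matrix Λ Λ ℝ) e' e :=
  inv_apply_comm (posDef_of_coercive hGs hg0 hg) e e'

/-- **`G⁻¹` is `1/Λ_G`-coercive** in the class binder shape `∀ x, (1/Λ_G)·Σ_e x_e² ≤ Σ_{e,e′} G⁻¹ e e′ x_e x_{e′}`, from `g·‖x‖² ≤ ⟨x,Gx⟩ ≤ Λ_G‖x‖²`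
(n08-b's covariance-side door `…ClassAppendixC.coercive_inv_of_form_le`, re-exported in the shape the class theorems display).
[cite: BenfattoEtAl1978, Appendix C point 1) (C.2)–(C.5) p.164 (class form)] -/
theorem inv_coercive_of_form_le (hGs : ∀ e e', G e e' = G e' e) (hg0 : 0 < g)
    (hg : ∀ x : Λ → ℝ, g * ∑ e, x e ^ 2 ≤ ∑ e, ∑ e', G e e' * x e * x e')
    (hΛG : ∀ x : Λ → ℝ, ∑ e, ∑ e', G e e' * x e * x e' ≤ ΛG * ∑ e, x e ^ 2) :
    ∀ x : Λ → ℝ, 1 / ΛG * ∑ e, x e ^ 2 ≤ ∑ e, ∑ e', (G⁻¹ : Matrix Λ Λ ℝ) e e' * x e * x e' :=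
  fun x => coercive_inv_of_form_le hGs hg0 hg hΛG x

/-- **The covariance's OWN Euclidean Combes–Thomas row**: entrywise decay `|G e e′| ≤ K_G e^{−κ|e−e′|₂}` (`κ > 0`) gives, at any rate
`0 ≤ θ₁ ≤ κ/4`, `Σ_{e′}|G e e′|(cosh(θ₁|e−e′|₂) − 1) ≤ J_G(θ₁) = K_G·(32θ₁²/κ²)·K_d(κ/2)` — n08-d's `…ClassEntryRows.classRow_Jc_le_of_abs_le_exp` APPLIED TO `G`.
[cite: BenfattoEtAl1978, Appendix C (C.1)–(C.2) p.164 (class form; ours)] -/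
theorem cov_rowDefect_le (hKG : 0 ≤ KG) (hκ : 0 < κ) {θ₁ : ℝ} (hθ₁ : 0 ≤ θ₁) (hθ₁κ : θ₁ ≤ κ / 4)
    (hGdec : ∀ e e' : Λ, |G e e'| ≤ KG * Real.exp (-(κ * Real.sqrt (∑ j, ((((e : B1Eq324BenfattoLemma.Site d) j : ℝ) - ((e' : B1Eq324BenfattoLemma.Site d) j : ℝ))) ^ 2))))
    (e : Λ) :
    ∑ e' : Λ, |G e e'| * (Real.cosh (θ₁ * Real.sqrt (∑ j, ((((e : B1Eq324BenfattoLemma.Site d) j : ℝ) - ((e' : B1Eq324BenfattoLemma.Site d) j : ℝ))) ^ 2)) - 1) ≤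
      KG * (32 * θ₁ ^ 2 / κ ^ 2) * (2 / (1 - Real.exp (-(κ / 2 / Real.sqrt d))) * Real.exp (κ / 2 / Real.sqrt d)) ^ d :=
  classRow_Jc_le_of_abs_le_exp hKG hκ hθ₁ hθ₁κ hGdec e

/-- ★★ **(C.2) for the class, precision side, FROM COVARIANCE DATA**: if the covariance `G` is symmetric, `g`-coercive and entrywise decaying
(`|G e e′| ≤ K_G e^{−κ|e−e′|₂}`), then at any rate `0 ≤ θ₁ ≤ κ/4` with `J_G(θ₁) < g` the PRECISION decays:
`|G⁻¹ x y| ≤ e^{−θ₁|x−y|₂}/(g − J_G(θ₁))` — n08-b's Combes–Thomas bound `…ClassAppendixC.abs_inv_apply_le_exp` applied TO `G` in the Euclidean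
site distance (pseudometric axioms `l2_self`/`l2_comm`/`l2_triangle` of `…KernelSect5ClassRows`).
[cite: BenfattoEtAl1978, Appendix C (C.2) p.164 (class form; route: Combes–Thomas 1973)] -/
theorem abs_inv_apply_le_exp_of_covariance (hGs : ∀ e e', G e e' = G e' e) (hg0 : 0 < g)
    (hg : ∀ x : Λ → ℝ, g * ∑ e, x e ^ 2 ≤ ∑ e, ∑ e', G e e' * x e * x e')
    (hKG : 0 ≤ KG) (hκ : 0 < κ) {θ₁ : ℝ} (hθ₁ : 0 ≤ θ₁) (hθ₁κ : θ₁ ≤ κ / 4)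
    (hGdec : ∀ e e' : Λ, |G e e'| ≤ KG * Real.exp (-(κ * Real.sqrt (∑ j, ((((e : B1Eq324BenfattoLemma.Site d) j : ℝ) - ((e' : B1Eq324BenfattoLemma.Site d) j : ℝ))) ^ 2))))
    (hJ : KG * (32 * θ₁ ^ 2 / κ ^ 2) * (2 / (1 - Real.exp (-(κ / 2 / Real.sqrt d))) * Real.exp (κ / 2 / Real.sqrt d)) ^ d < g)
    (x y : Λ) :
    |(G⁻¹ : Matrix Λ Λ ℝ) x y| ≤
      Real.exp (-(θ₁ * Real.sqrt (∑ j, ((((x : B1Eq324BenfattoLemma.Site d) j : ℝ) - ((y : B1Eq324BenfattoLemma.Site d) j : ℝ))) ^ 2))) /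
        (g - KG * (32 * θ₁ ^ 2 / κ ^ 2) * (2 / (1 - Real.exp (-(κ / 2 / Real.sqrt d))) * Real.exp (κ / 2 / Real.sqrt d)) ^ d) :=
  abs_inv_apply_le_exp hGs
    (dist := fun e e' : Λ => Real.sqrt (∑ j, ((((e : B1Eq324BenfattoLemma.Site d) j : ℝ) - ((e' : B1Eq324BenfattoLemma.Site d) j : ℝ))) ^ 2))
    (fun e => l2_self (e : B1Eq324BenfattoLemma.Site d))
    (fun e e' => l2_comm (e : B1Eq324BenfattoLemma.Site d) (e' : B1Eq324BenfattoLemma.Site d))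
    (fun e e' e'' => l2_triangle (e : B1Eq324BenfattoLemma.Site d) (e' : B1Eq324BenfattoLemma.Site d) (e'' : B1Eq324BenfattoLemma.Site d))
    hg0 hg (cov_rowDefect_le hKG hκ hθ₁ hθ₁κ hGdec) hθ₁ hJ x y

/-- The same decay in the `K·e^{−κ|x−y|₂}` currency of n08-d's `…ClassEntryRows` §4: `|G⁻¹ x y| ≤ (1/(g − J_G(θ₁)))·e^{−θ₁|x−y|₂}`.
[cite: BenfattoEtAl1978, Appendix C (C.2) p.164 (class form; route: Combes–Thomas 1973)] -/
theorem abs_inv_apply_le_mul_exp_of_covariance (hGs : ∀ e e', G e e' = G e' e) (hg0 : 0 < g)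
    (hg : ∀ x : Λ → ℝ, g * ∑ e, x e ^ 2 ≤ ∑ e, ∑ e', G e e' * x e * x e')
    (hKG : 0 ≤ KG) (hκ : 0 < κ) {θ₁ : ℝ} (hθ₁ : 0 ≤ θ₁) (hθ₁κ : θ₁ ≤ κ / 4)
    (hGdec : ∀ e e' : Λ, |G e e'| ≤ KG * Real.exp (-(κ * Real.sqrt (∑ j, ((((e : B1Eq324BenfattoLemma.Site d) j : ℝ) - ((e' : B1Eq324BenfattoLemma.Site d) j : ℝ))) ^ 2))))
    (hJ : KG * (32 * θ₁ ^ 2 / κ ^ 2) * (2 / (1 - Real.exp (-(κ / 2 / Real.sqrt d))) * Real.exp (κ / 2 / Real.sqrt d)) ^ d < g) :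
    ∀ x y : Λ, |(G⁻¹ : Matrix Λ Λ ℝ) x y| ≤
      1 / (g - KG * (32 * θ₁ ^ 2 / κ ^ 2) * (2 / (1 - Real.exp (-(κ / 2 / Real.sqrt d))) * Real.exp (κ / 2 / Real.sqrt d)) ^ d) *
        Real.exp (-(θ₁ * Real.sqrt (∑ j, ((((x : B1Eq324BenfattoLemma.Site d) j : ℝ) - ((y : B1Eq324BenfattoLemma.Site d) j : ℝ))) ^ 2))) := by
  intro x y
  rw [one_div_mul_eq_div]
  exact abs_inv_apply_le_exp_of_covariance hGs hg0 hg hKG hκ hθ₁ hθ₁κ hGdec hJ x y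

/-! ## §2  The precision rows `hJc`, `hM`, `hM₂` of `G⁻¹` from the covariance data -/

/-- **Row `hJc` of `G⁻¹` from covariance data, small of order `θ²`**: at `0 < θ₁ ≤ κ/4` with `J_G(θ₁) < g` and any `0 ≤ θ ≤ θ₁/4`,
`Σ_{e′}|G⁻¹ e e′|(cosh(θ|e−e′|₂) − 1) ≤ (1/(g − J_G(θ₁)))·(32θ²/θ₁²)·K_d(θ₁/2)` (n08-d's `classRow_Jc_le_of_abs_le_exp` at `(K, κ) := (1/(g − J_G), θ₁)`).
[cite: BenfattoEtAl1978, Appendix C (C.1)–(C.2) p.164; Balaban1985BackgroundPropagators, Sect. E p.428 (class form; ours)] -/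
theorem classRow_Jc_le_of_covariance (hGs : ∀ e e', G e e' = G e' e) (hg0 : 0 < g)
    (hg : ∀ x : Λ → ℝ, g * ∑ e, x e ^ 2 ≤ ∑ e, ∑ e', G e e' * x e * x e')
    (hKG : 0 ≤ KG) (hκ : 0 < κ) {θ₁ : ℝ} (hθ₁ : 0 < θ₁) (hθ₁κ : θ₁ ≤ κ / 4)
    (hGdec : ∀ e e' : Λ, |G e e'| ≤ KG * Real.exp (-(κ * Real.sqrt (∑ j, ((((e : B1Eq324BenfattoLemma.Site d) j : ℝ) - ((e' : B1Eq324BenfattoLemma.Site d) j : ℝ))) ^ 2))))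
    (hJ : KG * (32 * θ₁ ^ 2 / κ ^ 2) * (2 / (1 - Real.exp (-(κ / 2 / Real.sqrt d))) * Real.exp (κ / 2 / Real.sqrt d)) ^ d < g)
    {θ : ℝ} (hθ : 0 ≤ θ) (hθθ₁ : θ ≤ θ₁ / 4) (e : Λ) :
    ∑ e' : Λ, |(G⁻¹ : Matrix Λ Λ ℝ) e e'| * (Real.cosh (θ * Real.sqrt (∑ j, ((((e : B1Eq324BenfattoLemma.Site d) j : ℝ) - ((e' : B1Eq324BenfattoLemma.Site d) j : ℝ))) ^ 2)) - 1) ≤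
      1 / (g - KG * (32 * θ₁ ^ 2 / κ ^ 2) * (2 / (1 - Real.exp (-(κ / 2 / Real.sqrt d))) * Real.exp (κ / 2 / Real.sqrt d)) ^ d) *
        (32 * θ ^ 2 / θ₁ ^ 2) * (2 / (1 - Real.exp (-(θ₁ / 2 / Real.sqrt d))) * Real.exp (θ₁ / 2 / Real.sqrt d)) ^ d :=
  classRow_Jc_le_of_abs_le_exp (one_div_nonneg.mpr (sub_pos.mpr hJ).le) hθ₁ hθ hθθ₁
    (abs_inv_apply_le_mul_exp_of_covariance hGs hg0 hg hKG hκ hθ₁.le hθ₁κ hGdec hJ) e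

/-- **Row `hM` of `G⁻¹` from covariance data**: `Σ_{e′}|G⁻¹ e e′|(1 + |e−e′|₂) ≤ (1/(g − J_G(θ₁)))·((1 + 2/θ₁)·K_d(θ₁/2))`
(n08-d's `classRow_M_le_of_abs_le_exp` at `(K, κ) := (1/(g − J_G), θ₁)`). [cite: BenfattoEtAl1978, Appendix C (C.1)–(C.2) p.164 (class form; ours)] -/
theorem classRow_M_le_of_covariance (hGs : ∀ e e', G e e' = G e' e) (hg0 : 0 < g)
    (hg : ∀ x : Λ → ℝ, g * ∑ e, x e ^ 2 ≤ ∑ e, ∑ e', G e e' * x e * x e')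
    (hKG : 0 ≤ KG) (hκ : 0 < κ) {θ₁ : ℝ} (hθ₁ : 0 < θ₁) (hθ₁κ : θ₁ ≤ κ / 4)
    (hGdec : ∀ e e' : Λ, |G e e'| ≤ KG * Real.exp (-(κ * Real.sqrt (∑ j, ((((e : B1Eq324BenfattoLemma.Site d) j : ℝ) - ((e' : B1Eq324BenfattoLemma.Site d) j : ℝ))) ^ 2))))
    (hJ : KG * (32 * θ₁ ^ 2 / κ ^ 2) * (2 / (1 - Real.exp (-(κ / 2 / Real.sqrt d))) * Real.exp (κ / 2 / Real.sqrt d)) ^ d < g)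
    (e : Λ) :
    ∑ e' : Λ, |(G⁻¹ : Matrix Λ Λ ℝ) e e'| * (1 + Real.sqrt (∑ j, ((((e : B1Eq324BenfattoLemma.Site d) j : ℝ) - ((e' : B1Eq324BenfattoLemma.Site d) j : ℝ))) ^ 2)) ≤
      1 / (g - KG * (32 * θ₁ ^ 2 / κ ^ 2) * (2 / (1 - Real.exp (-(κ / 2 / Real.sqrt d))) * Real.exp (κ / 2 / Real.sqrt d)) ^ d) *
        ((1 + 2 / θ₁) * (2 / (1 - Real.exp (-(θ₁ / 2 / Real.sqrt d))) * Real.exp (θ₁ / 2 / Real.sqrt d)) ^ d) :=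
  classRow_M_le_of_abs_le_exp (one_div_nonneg.mpr (sub_pos.mpr hJ).le) hθ₁
    (abs_inv_apply_le_mul_exp_of_covariance hGs hg0 hg hKG hκ hθ₁.le hθ₁κ hGdec hJ) e

/-- **Row `hM₂` of `G⁻¹` from covariance data**: at any `θ ≤ θ₁`, `Σ_{e′}|G⁻¹ e e′|e^{(θ/2)|e−e′|₂} ≤ (1/(g − J_G(θ₁)))·K_d(θ₁/2)`
(n08-d's `classRow_M₂_le_of_abs_le_exp` at `(K, κ) := (1/(g − J_G), θ₁)`). [cite: BenfattoEtAl1978, Appendix C (C.2), (C.7) p.164 (class form; ours)] -/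
theorem classRow_M₂_le_of_covariance (hGs : ∀ e e', G e e' = G e' e) (hg0 : 0 < g)
    (hg : ∀ x : Λ → ℝ, g * ∑ e, x e ^ 2 ≤ ∑ e, ∑ e', G e e' * x e * x e')
    (hKG : 0 ≤ KG) (hκ : 0 < κ) {θ₁ : ℝ} (hθ₁ : 0 < θ₁) (hθ₁κ : θ₁ ≤ κ / 4)
    (hGdec : ∀ e e' : Λ, |G e e'| ≤ KG * Real.exp (-(κ * Real.sqrt (∑ j, ((((e : B1Eq324BenfattoLemma.Site d) j : ℝ) - ((e' : B1Eq324BenfattoLemma.Site d) j : ℝ))) ^ 2))))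
    (hJ : KG * (32 * θ₁ ^ 2 / κ ^ 2) * (2 / (1 - Real.exp (-(κ / 2 / Real.sqrt d))) * Real.exp (κ / 2 / Real.sqrt d)) ^ d < g)
    {θ : ℝ} (hθθ₁ : θ ≤ θ₁) (e : Λ) :
    ∑ e' : Λ, |(G⁻¹ : Matrix Λ Λ ℝ) e e'| * Real.exp (θ / 2 * Real.sqrt (∑ j, ((((e : B1Eq324BenfattoLemma.Site d) j : ℝ) - ((e' : B1Eq324BenfattoLemma.Site d) j : ℝ))) ^ 2)) ≤
      1 / (g - KG * (32 * θ₁ ^ 2 / κ ^ 2) * (2 / (1 - Real.exp (-(κ / 2 / Real.sqrt d))) * Real.exp (κ / 2 / Real.sqrt d)) ^ d) *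
        (2 / (1 - Real.exp (-(θ₁ / 2 / Real.sqrt d))) * Real.exp (θ₁ / 2 / Real.sqrt d)) ^ d :=
  classRow_M₂_le_of_abs_le_exp (one_div_nonneg.mpr (sub_pos.mpr hJ).le) hθ₁ hθθ₁
    (abs_inv_apply_le_mul_exp_of_covariance hGs hg0 hg hKG hκ hθ₁.le hθ₁κ hGdec hJ) e

/-! ## §3  The package: an elliptic exponentially decaying COVARIANCE gives a class member with explicit constants -/

/-- ★★★ **CLASS ENTRY FROM THE COVARIANCE.**  Let `G : Matrix Λ Λ ℝ` (finite `Λ ⊂ ℤ^d`) be symmetric, `g`-coercive (`g·Σx² ≤ ⟨x,Gx⟩`, `g > 0`),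
form-bounded (`⟨x,Gx⟩ ≤ Λ_G·Σx²`) and entrywise decaying (`|G e e′| ≤ K_G e^{−κ|e−e′|₂}`, `K_G ≥ 0`, `κ > 0`); fix a covariance rate `0 < θ₁ ≤ κ/4` with
`J_G(θ₁) = K_G·(32θ₁²/κ²)·K_d(κ/2) < g` and a precision rate `0 < θ ≤ θ₁/4`.  Then the PRECISION `A := G⁻¹` is symmetric, `1/Λ_G`-coercive, and meets
the six displayed rows of the class theorems (`…KernelSect5LowerAssembly.exp_cumulantSum_sub_le_integral_of_ledger` & co., in their order
`hJc hV hM hV₂ hM₂ hV₄`) with `J_c = (1/(g − J_G))·(32θ²/θ₁²)·K_d(θ₁/2)`, `V = (1 + 2/θ)K_d(θ/2)`, `M = (1/(g − J_G))·((1 + 2/θ₁)K_d(θ₁/2))`,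
`V₂ = K_d(θ/2)`, `M₂ = (1/(g − J_G))·K_d(θ₁/2)`, `V₄ = (1 + 8/θ)K_d(θ/8)`, `K_d(c) = (2/(1 − e^{−c/√d})·e^{c/√d})^d` — UNIFORMLY IN `Λ`.  The strict
row condition `J_c < γ_A = 1/Λ_G` is then met by taking `θ` small (`exists_precisionRate`), the corridor guard by taking the corridor wide.
[cite: BenfattoEtAl1978, Appendix C 1) (C.2)–(C.5) p.164; Balaban1985BackgroundPropagators, Sect. E p.428 (class form; ours)] -/
theorem classRows_of_covariance (hGs : ∀ e e', G e e' = G e' e) (hg0 : 0 < g)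
    (hg : ∀ x : Λ → ℝ, g * ∑ e, x e ^ 2 ≤ ∑ e, ∑ e', G e e' * x e * x e')
    (hΛG : ∀ x : Λ → ℝ, ∑ e, ∑ e', G e e' * x e * x e' ≤ ΛG * ∑ e, x e ^ 2)
    (hKG : 0 ≤ KG) (hκ : 0 < κ)
    (hGdec : ∀ e e' : Λ, |G e e'| ≤ KG * Real.exp (-(κ * Real.sqrt (∑ j, ((((e : B1Eq324BenfattoLemma.Site d) j : ℝ) - ((e' : B1Eq324BenfattoLemma.Site d) j : ℝ))) ^ 2))))
    {θ₁ : ℝ} (hθ₁ : 0 < θ₁) (hθ₁κ : θ₁ ≤ κ / 4)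
    (hJ : KG * (32 * θ₁ ^ 2 / κ ^ 2) * (2 / (1 - Real.exp (-(κ / 2 / Real.sqrt d))) * Real.exp (κ / 2 / Real.sqrt d)) ^ d < g)
    {θ : ℝ} (hθ : 0 < θ) (hθθ₁ : θ ≤ θ₁ / 4) :
    (∀ e e' : Λ, (G⁻¹ : Matrix Λ Λ ℝ) e e' = (G⁻¹ : Matrix Λ Λ ℝ) e' e) ∧
    (∀ x : Λ → ℝ, 1 / ΛG * ∑ e, x e ^ 2 ≤ ∑ e, ∑ e', (G⁻¹ : Matrix Λ Λ ℝ) e e' * x e * x e') ∧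
    (∀ e : Λ, ∑ e' : Λ, |(G⁻¹ : Matrix Λ Λ ℝ) e e'| * (Real.cosh (θ * Real.sqrt (∑ j, ((((e : B1Eq324BenfattoLemma.Site d) j : ℝ) - ((e' : B1Eq324BenfattoLemma.Site d) j : ℝ))) ^ 2)) - 1) ≤
        1 / (g - KG * (32 * θ₁ ^ 2 / κ ^ 2) * (2 / (1 - Real.exp (-(κ / 2 / Real.sqrt d))) * Real.exp (κ / 2 / Real.sqrt d)) ^ d) *
          (32 * θ ^ 2 / θ₁ ^ 2) * (2 / (1 - Real.exp (-(θ₁ / 2 / Real.sqrt d))) * Real.exp (θ₁ / 2 / Real.sqrt d)) ^ d) ∧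
    (∀ e : Λ, ∑ e' : Λ, Real.exp (-(θ * Real.sqrt (∑ j, ((((e : B1Eq324BenfattoLemma.Site d) j : ℝ) - ((e' : B1Eq324BenfattoLemma.Site d) j : ℝ))) ^ 2))) *
        (1 + Real.sqrt (∑ j, ((((e : B1Eq324BenfattoLemma.Site d) j : ℝ) - ((e' : B1Eq324BenfattoLemma.Site d) j : ℝ))) ^ 2)) ≤
        (1 + 2 / θ) * (2 / (1 - Real.exp (-(θ / 2 / Real.sqrt d))) * Real.exp (θ / 2 / Real.sqrt d)) ^ d) ∧
    (∀ e : Λ, ∑ e' : Λ, |(G⁻¹ : Matrix Λ Λ ℝ) e e'| * (1 + Real.sqrt (∑ j, ((((e : B1Eq324BenfattoLemma.Site d) j : ℝ) - ((e' : B1Eq324BenfattoLemma.Site d) j : ℝ))) ^ 2)) ≤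
        1 / (g - KG * (32 * θ₁ ^ 2 / κ ^ 2) * (2 / (1 - Real.exp (-(κ / 2 / Real.sqrt d))) * Real.exp (κ / 2 / Real.sqrt d)) ^ d) *
          ((1 + 2 / θ₁) * (2 / (1 - Real.exp (-(θ₁ / 2 / Real.sqrt d))) * Real.exp (θ₁ / 2 / Real.sqrt d)) ^ d)) ∧
    (∀ e : Λ, ∑ e' : Λ, Real.exp (-(θ / 2 * Real.sqrt (∑ j, ((((e : B1Eq324BenfattoLemma.Site d) j : ℝ) - ((e' : B1Eq324BenfattoLemma.Site d) j : ℝ))) ^ 2))) ≤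
        (2 / (1 - Real.exp (-(θ / 2 / Real.sqrt d))) * Real.exp (θ / 2 / Real.sqrt d)) ^ d) ∧
    (∀ e : Λ, ∑ e' : Λ, |(G⁻¹ : Matrix Λ Λ ℝ) e e'| * Real.exp (θ / 2 * Real.sqrt (∑ j, ((((e : B1Eq324BenfattoLemma.Site d) j : ℝ) - ((e' : B1Eq324BenfattoLemma.Site d) j : ℝ))) ^ 2)) ≤
        1 / (g - KG * (32 * θ₁ ^ 2 / κ ^ 2) * (2 / (1 - Real.exp (-(κ / 2 / Real.sqrt d))) * Real.exp (κ / 2 / Real.sqrt d)) ^ d) *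
          (2 / (1 - Real.exp (-(θ₁ / 2 / Real.sqrt d))) * Real.exp (θ₁ / 2 / Real.sqrt d)) ^ d) ∧
    (∀ e : Λ, ∑ e' : Λ, Real.exp (-(θ / 4 * Real.sqrt (∑ j, ((((e : B1Eq324BenfattoLemma.Site d) j : ℝ) - ((e' : B1Eq324BenfattoLemma.Site d) j : ℝ))) ^ 2))) *
        (1 + Real.sqrt (∑ j, ((((e : B1Eq324BenfattoLemma.Site d) j : ℝ) - ((e' : B1Eq324BenfattoLemma.Site d) j : ℝ))) ^ 2)) ≤
        (1 + 8 / θ) * (2 / (1 - Real.exp (-(θ / 8 / Real.sqrt d))) * Real.exp (θ / 8 / Real.sqrt d)) ^ d) :=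
  ⟨inv_symm_of_coercive hGs hg0 hg, inv_coercive_of_form_le hGs hg0 hg hΛG,
    classRow_Jc_le_of_covariance hGs hg0 hg hKG hκ hθ₁ hθ₁κ hGdec hJ hθ.le hθθ₁, fun e => classRow_V_le hθ e,
    classRow_M_le_of_covariance hGs hg0 hg hKG hκ hθ₁ hθ₁κ hGdec hJ, fun e => classRow_V₂_le hθ e,
    classRow_M₂_le_of_covariance hGs hg0 hg hKG hκ hθ₁ hθ₁κ hGdec hJ (by linarith), fun e => classRow_V₄_le hθ e⟩

/-- **The covariance rate exists**: `g > 0`, `K_G ≥ 0`, `κ > 0` ⇒ some `θ₁ ∈ (0, κ/4]` has `J_G(θ₁) = K_G·(32θ₁²/κ²)·K_d(κ/2) < g`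
(`J_G(θ₁) = O(θ₁²)`). [cite: BenfattoEtAl1978, Appendix C (C.1)–(C.2) p.164 (class form; ours)] -/
theorem exists_covRate (hg0 : 0 < g) (hKG : 0 ≤ KG) (hκ : 0 < κ) :
    ∃ θ₁ : ℝ, 0 < θ₁ ∧ θ₁ ≤ κ / 4 ∧
      KG * (32 * θ₁ ^ 2 / κ ^ 2) * (2 / (1 - Real.exp (-(κ / 2 / Real.sqrt d))) * Real.exp (κ / 2 / Real.sqrt d)) ^ d < g := by
  have hKd : 0 ≤ (2 / (1 - Real.exp (-(κ / 2 / Real.sqrt d))) * Real.exp (κ / 2 / Real.sqrt d)) ^ d :=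
    latticeConst_nonneg (by positivity)
  obtain ⟨θ₁, h0, hb, hlt⟩ := exists_small_rate (C := KG * (32 / κ ^ 2) * (2 / (1 - Real.exp (-(κ / 2 / Real.sqrt d))) * Real.exp (κ / 2 / Real.sqrt d)) ^ d)
    (b := κ / 4) (t := g) (by positivity) (by positivity) hg0
  refine ⟨θ₁, h0, hb, ?_⟩
  have hrw : KG * (32 * θ₁ ^ 2 / κ ^ 2) * (2 / (1 - Real.exp (-(κ / 2 / Real.sqrt d))) * Real.exp (κ / 2 / Real.sqrt d)) ^ d =
      KG * (32 / κ ^ 2) * (2 / (1 - Real.exp (-(κ / 2 / Real.sqrt d))) * Real.exp (κ / 2 / Real.sqrt d)) ^ d * θ₁ ^ 2 := by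
    ring
  rw [hrw]
  exact hlt

/-- **The precision rate exists**: with the covariance rate `θ₁ > 0` fixed (`J_G(θ₁) < g`) and `Λ_G > 0`, some `θ ∈ (0, θ₁/4]` makes the Combes–Thomas
row of `G⁻¹` strictly smaller than its coercivity constant: `(1/(g − J_G(θ₁)))·(32θ²/θ₁²)·K_d(θ₁/2) < 1/Λ_G` — the class condition `J_c < γ_A`.
[cite: BenfattoEtAl1978, Appendix C (C.1)–(C.2) p.164; Balaban1985BackgroundPropagators, Sect. E p.428 (class form; ours)] -/
theorem exists_precisionRate (hΛG0 : 0 < ΛG) {θ₁ : ℝ} (hθ₁ : 0 < θ₁)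
    (hJ : KG * (32 * θ₁ ^ 2 / κ ^ 2) * (2 / (1 - Real.exp (-(κ / 2 / Real.sqrt d))) * Real.exp (κ / 2 / Real.sqrt d)) ^ d < g) :
    ∃ θ : ℝ, 0 < θ ∧ θ ≤ θ₁ / 4 ∧
      1 / (g - KG * (32 * θ₁ ^ 2 / κ ^ 2) * (2 / (1 - Real.exp (-(κ / 2 / Real.sqrt d))) * Real.exp (κ / 2 / Real.sqrt d)) ^ d) *
          (32 * θ ^ 2 / θ₁ ^ 2) * (2 / (1 - Real.exp (-(θ₁ / 2 / Real.sqrt d))) * Real.exp (θ₁ / 2 / Real.sqrt d)) ^ d < 1 / ΛG := by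
  have hKd : 0 ≤ (2 / (1 - Real.exp (-(θ₁ / 2 / Real.sqrt d))) * Real.exp (θ₁ / 2 / Real.sqrt d)) ^ d :=
    latticeConst_nonneg (by positivity)
  have hgap : 0 ≤ 1 / (g - KG * (32 * θ₁ ^ 2 / κ ^ 2) * (2 / (1 - Real.exp (-(κ / 2 / Real.sqrt d))) * Real.exp (κ / 2 / Real.sqrt d)) ^ d) :=
    one_div_nonneg.mpr (sub_pos.mpr hJ).le
  obtain ⟨θ, h0, hb, hlt⟩ := exists_small_rate
    (C := 1 / (g - KG * (32 * θ₁ ^ 2 / κ ^ 2) * (2 / (1 - Real.exp (-(κ / 2 / Real.sqrt d))) * Real.exp (κ / 2 / Real.sqrt d)) ^ d) *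
      (32 / θ₁ ^ 2) * (2 / (1 - Real.exp (-(θ₁ / 2 / Real.sqrt d))) * Real.exp (θ₁ / 2 / Real.sqrt d)) ^ d)
    (b := θ₁ / 4) (t := 1 / ΛG) (by positivity) (by positivity) (by positivity)
  refine ⟨θ, h0, hb, ?_⟩
  have hrw : 1 / (g - KG * (32 * θ₁ ^ 2 / κ ^ 2) * (2 / (1 - Real.exp (-(κ / 2 / Real.sqrt d))) * Real.exp (κ / 2 / Real.sqrt d)) ^ d) *
        (32 * θ ^ 2 / θ₁ ^ 2) * (2 / (1 - Real.exp (-(θ₁ / 2 / Real.sqrt d))) * Real.exp (θ₁ / 2 / Real.sqrt d)) ^ d =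
      1 / (g - KG * (32 * θ₁ ^ 2 / κ ^ 2) * (2 / (1 - Real.exp (-(κ / 2 / Real.sqrt d))) * Real.exp (κ / 2 / Real.sqrt d)) ^ d) *
        (32 / θ₁ ^ 2) * (2 / (1 - Real.exp (-(θ₁ / 2 / Real.sqrt d))) * Real.exp (θ₁ / 2 / Real.sqrt d)) ^ d * θ ^ 2 := by
    ring
  rw [hrw]
  exact hlt

/-- ★★★ **ELLIPTIC EXPONENTIALLY DECAYING COVARIANCE ⇒ CLASS MEMBER.**  If `G : Matrix Λ Λ ℝ` on a finite `Λ ⊂ ℤ^d` is symmetric, `g`-coercive (`g > 0`),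
form-bounded by `Λ_G > 0` and entrywise exponentially decaying (`|G e e′| ≤ K_G e^{−κ|e−e′|₂}`, `K_G ≥ 0`, `κ > 0`), then there are a rate `θ > 0` and constants
`γ_A > 0`, `J_c < γ_A`, `V, M, V₂, M₂, V₄` such that the precision `A := G⁻¹` is symmetric, `γ_A`-coercive and satisfies the six displayed rows
`hJc hV hM hV₂ hM₂ hV₄` of the class theorems — every binder of `…KernelSect5LowerAssembly.exp_cumulantSum_sub_le_integral_of_ledger` that concerns
`(Λ, A)` alone, from propagator bounds stated ON THE COVARIANCE (the currency of [Balaban1985UV3] p. 261 «a covariance having an exponential decay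
property»); the explicit constants are those of `classRows_of_covariance` at the rates of `exists_covRate` / `exists_precisionRate`.
[cite: BenfattoEtAl1978, Appendix C 1) (C.2)–(C.5) p.164; Balaban1985BackgroundPropagators, Sect. E p.428 (class form; ours)] -/
theorem exists_classRows_of_covariance (hGs : ∀ e e', G e e' = G e' e) (hg0 : 0 < g)
    (hg : ∀ x : Λ → ℝ, g * ∑ e, x e ^ 2 ≤ ∑ e, ∑ e', G e e' * x e * x e')
    (hΛG0 : 0 < ΛG) (hΛG : ∀ x : Λ → ℝ, ∑ e, ∑ e', G e e' * x e * x e' ≤ ΛG * ∑ e, x e ^ 2)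
    (hKG : 0 ≤ KG) (hκ : 0 < κ)
    (hGdec : ∀ e e' : Λ, |G e e'| ≤ KG * Real.exp (-(κ * Real.sqrt (∑ j, ((((e : B1Eq324BenfattoLemma.Site d) j : ℝ) - ((e' : B1Eq324BenfattoLemma.Site d) j : ℝ))) ^ 2)))) :
    ∃ θ γA Jc V M V₂ M₂ V₄ : ℝ, 0 < θ ∧ 0 < γA ∧ Jc < γA ∧
      (∀ e e' : Λ, (G⁻¹ : Matrix Λ Λ ℝ) e e' = (G⁻¹ : Matrix Λ Λ ℝ) e' e) ∧
      (∀ x : Λ → ℝ, γA * ∑ e, x e ^ 2 ≤ ∑ e, ∑ e', (G⁻¹ : Matrix Λ Λ ℝ) e e' * x e * x e') ∧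
      (∀ e : Λ, ∑ e' : Λ, |(G⁻¹ : Matrix Λ Λ ℝ) e e'| * (Real.cosh (θ * Real.sqrt (∑ j, ((((e : B1Eq324BenfattoLemma.Site d) j : ℝ) - ((e' : B1Eq324BenfattoLemma.Site d) j : ℝ))) ^ 2)) - 1) ≤ Jc) ∧
      (∀ e : Λ, ∑ e' : Λ, Real.exp (-(θ * Real.sqrt (∑ j, ((((e : B1Eq324BenfattoLemma.Site d) j : ℝ) - ((e' : B1Eq324BenfattoLemma.Site d) j : ℝ))) ^ 2))) *
          (1 + Real.sqrt (∑ j, ((((e : B1Eq324BenfattoLemma.Site d) j : ℝ) - ((e' : B1Eq324BenfattoLemma.Site d) j : ℝ))) ^ 2)) ≤ V) ∧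
      (∀ e : Λ, ∑ e' : Λ, |(G⁻¹ : Matrix Λ Λ ℝ) e e'| * (1 + Real.sqrt (∑ j, ((((e : B1Eq324BenfattoLemma.Site d) j : ℝ) - ((e' : B1Eq324BenfattoLemma.Site d) j : ℝ))) ^ 2)) ≤ M) ∧
      (∀ e : Λ, ∑ e' : Λ, Real.exp (-(θ / 2 * Real.sqrt (∑ j, ((((e : B1Eq324BenfattoLemma.Site d) j : ℝ) - ((e' : B1Eq324BenfattoLemma.Site d) j : ℝ))) ^ 2))) ≤ V₂) ∧
      (∀ e : Λ, ∑ e' : Λ, |(G⁻¹ : Matrix Λ Λ ℝ) e e'| * Real.exp (θ / 2 * Real.sqrt (∑ j, ((((e : B1Eq324BenfattoLemma.Site d) j : ℝ) - ((e' : B1Eq324BenfattoLemma.Site d) j : ℝ))) ^ 2)) ≤ M₂) ∧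
      (∀ e : Λ, ∑ e' : Λ, Real.exp (-(θ / 4 * Real.sqrt (∑ j, ((((e : B1Eq324BenfattoLemma.Site d) j : ℝ) - ((e' : B1Eq324BenfattoLemma.Site d) j : ℝ))) ^ 2))) *
          (1 + Real.sqrt (∑ j, ((((e : B1Eq324BenfattoLemma.Site d) j : ℝ) - ((e' : B1Eq324BenfattoLemma.Site d) j : ℝ))) ^ 2)) ≤ V₄) := by
  obtain ⟨θ₁, hθ₁, hθ₁κ, hJ⟩ := exists_covRate (d := d) hg0 hKG hκ
  obtain ⟨θ, hθ, hθθ₁, hlt⟩ := exists_precisionRate (d := d) hΛG0 hθ₁ hJ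
  obtain ⟨hs, hc, hJc, hV, hM, hV₂, hM₂, hV₄⟩ := classRows_of_covariance hGs hg0 hg hΛG hKG hκ hGdec hθ₁ hθ₁κ hJ hθ hθθ₁
  exact ⟨θ, 1 / ΛG, _, _, _, _, _, _, hθ, by positivity, hlt, hs, hc, hJc, hV, hM, hV₂, hM₂, hV₄⟩

end Literature.MathematicalPhysics.QuantumFieldTheory.Balaban1983to89.B1Eq324BenfattoClassEntryFromCovariance
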